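import Literature.AnabelianGeometry.SemiGraphs.ThetaRayFrameStepGeneral
import Literature.AnabelianGeometry.SemiGraphs.ThetaRayAnchorFreePair
import HarnessLib

/-!
# The general (♦) at `𝒢_θ(p,n)` and three tower lemmas (typed-form audit of [SemiAnbd] Thm 3.7 (iv) clause 2 at
# `𝒢_θ`, row «B9-GENERAL-PAIR», step (GP-2b))

Mochizuki, *Semi-graphs of anabelioids*, Publ. RIMS **42** (2006), §3, Theorem 3.7 (iii)/(iv) pp. 40–41,
Lemma 1.8 (ii) p. 20, Remark 2.2.1 p. 24 [cite: MochizukiSemiAnbd2006, Thm 3.7(iv) p.41].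

PROOF-ONLY file (abc-iut cell, layer L3, seat abc-iut-L3-d4 gen 7; row «B9-GENERAL-PAIR@𝒢_θ» (L3-lead γ61);
frontier / erratum-grade label, OUTSIDE the [IUTchIII] Cor. 3.12 cone; 0 definitions, no named fact):

* `thetaRayFreeProP_deepFixed_proj_fixed_gen` — **(♦) in general**: from an initial frame of `(g, K)` at a
  far vertex of the deep tree `𝔾̃_{N'}` of `𝒢_θ(p,n)`, every `g`-fixed vertex of `𝔾̃_{N'}` projects onto a
  vertex of `𝔾̃_{n₀}` fixed by every element of `K` (the frame induction `thetaRayFreeProP_frame_induction_gen`,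
  p497655, started at the initial frame; generalises abc-iut-L3-d4 gen 5's p480497 from `(c^{p^m}, c)`);
* `treeAct_vertexMap_eq_of_mem_closure_zpowers` — (any `𝒢`, canonical chart) a tree vertex fixed by `g` is
  fixed by the closed procyclic subgroup `closure⟨g⟩` (vertex stabilisers contain the open kernel of the
  level action, hence are closed);
* `height_le_of_le_level` — (any `𝒢`) a height bound for the `C`-fixed vertices of one level persists at all
  deeper levels (equivariant transitions over `𝔾`);
* `exists_forall_treeAct_vertexMap_eq_of_isCompact`, `treeTrans_fixed_and_over` — (any `𝒢`) compact
  subgroups fix vertices; projections of fixed vertices are fixed, over the same vertex of `𝔾`;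
* `thetaRayFreeProP_exists_far_orderOf_eq` — at `𝒢_θ(p,n)` the far branch generators of each level have one
  common order (yardstick: the escaping element of the standard apartment, p477446);
* `exists_coframe_of_forall_branchMap_eq` — (any `𝒢`) **co-frames from a fixed branch**: if every element of
  `K` fixes a branch `β₀` of `𝔾̃_{N'}` at `y`, there are a point sequence `P` over the vertex `w₀` of `𝔾` under
  `y` and a branch `b₀` of `𝔾` at `w₀` with `ρ_{N'}(k) = σ_{N'}^{b₀*(t_k)}` for every `k ∈ K` (Remark 2.2.1
  in cover coordinates: abc-iut-L3-d3's `stab_brOf_iff`, abc-iut-L3-d4's point sequences through a point).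

Nothing of [SemiAnbd] is asserted; nothing bears on [IUTchIII] Cor. 3.12; typed ≠ proved.
-/

noncomputable section

namespace Literature.AnabelianGeometry.SemiGraphs

open CategoryTheory Filter Topology Multiplicative
open ProfiniteSemiGraph ProfiniteSemiGraph.GaloisLevelData
open Literature.AnabelianGeometry.SemiGraphs.FreeProPRankTwo

namespace ProfiniteSemiGraph

universe u

/-! ### Three tower lemmas (any `𝒢`, canonical chart) -/

section Tower

variable (𝒢 : ProfiniteSemiGraph.{u}) (h36 : 𝒢.Prop36Hypotheses)

/-- **A tree vertex fixed by `g` is fixed by `closure⟨g⟩`**: the stabiliser of a vertex of `𝔾̃_N` in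
`π₁^temp(𝒢)` contains the open kernel of the level-`N` action, so it is an open, hence closed, subgroup.
[cite: MochizukiSemiAnbd2006, Thm 3.7(iii) p.41] -/
theorem treeAct_vertexMap_eq_of_mem_closure_zpowers (g : (𝒢.temperedPiChart h36).G) (N : ℕ)
    (y : ((𝒢.galoisLevelData h36).tree N).Vertex)
    (hy : ((𝒢.galoisLevelData h36).treeAct h36.isCountable N g).hom.vertexMap y = y) :
    ∀ x ∈ (Subgroup.zpowers g).topologicalClosure,
      ((𝒢.galoisLevelData h36).treeAct h36.isCountable N x).hom.vertexMap y = y := by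
  let Vd := verticialLevelData_temperedPiChart (h36 := h36)
  -- the stabiliser of `y`: a subgroup containing the open kernel, hence closed
  let St : Subgroup (𝒢.temperedPiChart h36).G :=
    { carrier := {x | (Vd.act N x).hom.vertexMap y = y}
      mul_mem' := fun {a b} ha hb => by
        change (Vd.act N (a * b)).hom.vertexMap y = y
        rw [map_mul, CategoryTheory.Aut.Aut_mul_def, Iso.trans_hom, SemiGraph.comp_vertexMap,
          Function.comp_apply]
        rw [Set.mem_setOf_eq] at ha hb
        rw [hb, ha]
      one_mem' := by
        change (Vd.act N 1).hom.vertexMap y = y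
        rw [map_one]
        rfl
      inv_mem' := fun {a} ha => by
        change (Vd.act N a⁻¹).hom.vertexMap y = y
        rw [Set.mem_setOf_eq] at ha
        rw [map_inv, CategoryTheory.Aut.Aut_inv_def, Iso.symm_hom]
        have h1 := congrArg (fun φ => SemiGraph.Hom.vertexMap φ y) (Vd.act N a).hom_inv_id
        simp only [SemiGraph.comp_vertexMap, Function.comp_apply, SemiGraph.id_vertexMap, id_eq] at h1
        conv_lhs => rw [← ha]
        exact h1 }
  have hker : (Vd.act N).ker ≤ St := by
    intro x hx
    change (Vd.act N x).hom.vertexMap y = y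
    have h1 : Vd.act N x = 1 := hx
    rw [h1]
    rfl
  have hSt : IsClosed (St : Set (𝒢.temperedPiChart h36).G) :=
    Subgroup.isClosed_of_isOpen _ (Subgroup.isOpen_mono hker (Vd.isOpen_ker N))
  have hgy : g ∈ St := hy
  have hle : (Subgroup.zpowers g).topologicalClosure ≤ St :=
    Subgroup.topologicalClosure_minimal _ ((Subgroup.zpowers_le).mpr hgy) hSt
  exact fun x hx => hle hx

/-- **A height bound for the fixed vertices of one level persists at all deeper levels** (projections of
fixed vertices are fixed and lie over the same vertex of `𝔾`). [cite: MochizukiSemiAnbd2006, Thm 3.7(iii) p.41] -/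
theorem height_le_of_le_level (H : 𝒢.graph.Vertex → ℕ) (C : Set (𝒢.temperedPiChart h36).G) {j B : ℕ}
    (hj : ∀ y : ((𝒢.galoisLevelData h36).tree j).Vertex,
      (∀ x ∈ C, ((𝒢.galoisLevelData h36).treeAct h36.isCountable j x).hom.vertexMap y = y) →
        B ≤ H (((𝒢.galoisLevelData h36).treeProj j).vertexMap y)) :
    ∀ N, j ≤ N → ∀ y : ((𝒢.galoisLevelData h36).tree N).Vertex,
      (∀ x ∈ C, ((𝒢.galoisLevelData h36).treeAct h36.isCountable N x).hom.vertexMap y = y) →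
        B ≤ H (((𝒢.galoisLevelData h36).treeProj N).vertexMap y) := by
  let Dg := 𝒢.galoisLevelData h36
  let Vd := verticialLevelData_temperedPiChart (h36 := h36)
  intro N hjN y hy
  have h1 : ∀ x ∈ C, (Vd.act j x).hom.vertexMap ((Vd.trans hjN).vertexMap y) = (Vd.trans hjN).vertexMap y := by
    intro x hx
    rw [← Vd.trans_act_vertexMap]
    exact congrArg _ (hy x hx)
  have h2 := hj _ h1
  have h3 : (Dg.treeProj j).vertexMap ((Dg.treeTrans hjN).vertexMap y) = (Dg.treeProj N).vertexMap y := by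
    have e := congrArg (fun φ => SemiGraph.Hom.vertexMap φ y) (Dg.treeTrans_over hjN)
    simpa only [SemiGraph.comp_vertexMap, Function.comp_apply] using e
  exact h2.trans_eq (congrArg H h3)

/-- **Co-frames from a fixed branch** (Remark 2.2.1 in cover coordinates): if every element of `K` fixes the
branch `β₀` of `𝔾̃_{N'}` at the vertex `y`, then for some point sequence `P` over the vertex `w₀` of `𝔾` under
`y` and some branch `b₀` of `𝔾` at `w₀`, `ρ_{N'}(k) = σ_{N'}^{b₀*(t_k)}` for every `k ∈ K`.
[cite: MochizukiSemiAnbd2006, Rmk 2.2.1 p.24] -/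
theorem exists_coframe_of_forall_branchMap_eq (K : Set (𝒢.temperedPiChart h36).G) (N' : ℕ)
    {y : ((𝒢.galoisLevelData h36).tree N').Vertex} (β₀ : ((𝒢.galoisLevelData h36).tree N').Branch)
    (hβ₀ : ((𝒢.galoisLevelData h36).tree N').abuts β₀ = some y)
    (hfix : ∀ k ∈ K, ((𝒢.galoisLevelData h36).treeAct h36.isCountable N' k).hom.branchMap β₀ = β₀) :
    ∃ (P : (𝒢.galoisLevelData h36).PointSeq h36.isCountable (((𝒢.galoisLevelData h36).treeProj N').vertexMap y))
      (b₀ : 𝒢.graph.Branch) (hb₀ : 𝒢.graph.abuts b₀ = some (((𝒢.galoisLevelData h36).treeProj N').vertexMap y)),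
      ∀ k ∈ K, ∃ t : 𝒢.Ge (𝒢.graph.edgeOf b₀),
        (𝒢.galoisLevelData h36).proj h36.isCountable N' k = P.gal N' (𝒢.brHom b₀ _ hb₀ t) := by
  classical
  let Dg := 𝒢.galoisLevelData h36
  have hc := h36.isCountable
  have hcover := Dg.cover_sameComponent hc
  have htrans := Dg.cover_htrans hc
  -- cover coordinates of `β₀`
  set β₀c := (Dg.treeIso hc N').inv.branchMap β₀ with hβ₀c
  have hβeq : β₀ = (Dg.treeIso hc N').hom.branchMap β₀c := (Dg.treeIso_hom_branchMap_inv hc N' β₀).symm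
  set b₀ : 𝒢.graph.Branch := β₀c.1.1 with hb₀def
  set w₀ := (Dg.treeProj N').vertexMap y with hw₀def
  have hb₀ : 𝒢.graph.abuts b₀ = some w₀ := by
    have h1 := (Dg.treeProj N').abuts_branchMap β₀ y hβ₀
    rwa [hβeq, Dg.treeProj_branchMap_treeIso hc] at h1
  have hKfix : ∀ k ∈ K, (CovObj.orbitGraphMap (Dg.proj hc N' k).hom).branchMap β₀c = β₀c := by
    intro k hk
    have hfixβ : (Dg.treeAct hc N' k).hom.branchMap β₀ = β₀ := hfix k hk
    rw [Dg.treeAct_apply hc, hβeq, Dg.galTreeAct_branchMap_treeIso hc] at hfixβ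
    have h2 := congrArg (Dg.treeIso hc N').inv.branchMap hfixβ
    rwa [Dg.treeIso_inv_branchMap_hom hc, Dg.treeIso_inv_branchMap_hom hc] at h2
  obtain ⟨yv, hyβ⟩ := (Dg.cover hc N').exists_eq_brOf b₀ hb₀ β₀c rfl
  rw [hyβ] at hKfix
  obtain ⟨Py, hPy, -⟩ := Dg.exists_pointSeq_pt_eq hc N' yv
  refine ⟨Py, b₀, hb₀, fun k hk => ?_⟩
  -- `ρ_{N'}(k) ∈ Stab(brOf b₀ yv) = ψ_{yv}(Π_{b₀})`
  have hq := hKfix k hk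
  obtain ⟨σ, hσ⟩ := (Dg.cover hc N').exists_aut_fV_eq (hcover N') (htrans N') yv yv
  rw [← hσ] at hq
  obtain ⟨a, ha, hqa⟩ := Subgroup.mem_map.mp
    (((Dg.cover hc N').stab_brOf_iff (hcover N') (htrans N') yv σ (Dg.proj hc N' k)).mp hq)
  have hσ1 : σ = 1 := (Dg.cover hc N').aut_eq_of_fV_eq (hcover N') yv (by rw [hσ]; rfl)
  subst hσ1
  have hqa' : Dg.proj hc N' k = a := by
    rw [← hqa]
    simp
  obtain ⟨x, hx, rfl⟩ := Subgroup.mem_map.mp ha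
  obtain ⟨t, rfl⟩ := hx
  refine ⟨t, ?_⟩
  rw [hqa']
  have h1 : Py.gal N' (𝒢.brHom b₀ w₀ hb₀ t) =
      (Dg.cover hc N').ptHom (hcover N') (htrans N') yv (𝒢.brHom b₀ w₀ hb₀ t) := by
    rw [← hPy]
    exact (Py.eq_gal N' _ _ ((Dg.cover hc N').ptHom_apply (hcover N') (htrans N') (Py.pt N') _)).symm
  rw [h1]
  rfl

/-- Compact subgroups fix a vertex of every level tree (Lemma 1.8 (ii) form, abc-iut-L3-t6's
`SemiGraph.exists_fixed_vertex_of_isCompact_over` at the canonical tower). [cite: MochizukiSemiAnbd2006, Lem. 1.8(ii) p.20] -/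
theorem exists_forall_treeAct_vertexMap_eq_of_isCompact (C : Subgroup (𝒢.temperedPiChart h36).G)
    (hC : IsCompact (C : Set (𝒢.temperedPiChart h36).G)) (j : ℕ) :
    ∃ y : ((𝒢.galoisLevelData h36).tree j).Vertex,
      ∀ x ∈ C, ((𝒢.galoisLevelData h36).treeAct h36.isCountable j x).hom.vertexMap y = y := by
  let Vd := verticialLevelData_temperedPiChart (h36 := h36)
  obtain ⟨y, hy⟩ := SemiGraph.exists_fixed_vertex_of_isCompact_over C hC (Vd.isTree j) (Vd.vertex j)
    (Vd.proj j) (Vd.act j) (Vd.isOpen_ker j) (Vd.act_over j)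
  exact ⟨y, fun x hx => hy ⟨x, hx⟩⟩

/-- Projections of `C`-fixed tree vertices are `C`-fixed and lie over the same vertex of `𝔾`.
[cite: MochizukiSemiAnbd2006, Thm 3.7(iii) p.41] -/
theorem treeTrans_fixed_and_over (C : Set (𝒢.temperedPiChart h36).G) {i N : ℕ} (h : i ≤ N)
    (y : ((𝒢.galoisLevelData h36).tree N).Vertex)
    (hy : ∀ x ∈ C, ((𝒢.galoisLevelData h36).treeAct h36.isCountable N x).hom.vertexMap y = y) :
    (∀ x ∈ C, ((𝒢.galoisLevelData h36).treeAct h36.isCountable i x).hom.vertexMap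
        (((𝒢.galoisLevelData h36).treeTrans h).vertexMap y) = ((𝒢.galoisLevelData h36).treeTrans h).vertexMap y) ∧
      ((𝒢.galoisLevelData h36).treeProj i).vertexMap (((𝒢.galoisLevelData h36).treeTrans h).vertexMap y) =
        ((𝒢.galoisLevelData h36).treeProj N).vertexMap y := by
  let Dg := 𝒢.galoisLevelData h36
  let Vd := verticialLevelData_temperedPiChart (h36 := h36)
  refine ⟨fun x hx => ?_, ?_⟩
  · have h1 := Vd.trans_act_vertexMap h x y
    change (Dg.treeTrans h).vertexMap ((Dg.treeAct h36.isCountable N x).hom.vertexMap y) =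
      (Dg.treeAct h36.isCountable i x).hom.vertexMap ((Dg.treeTrans h).vertexMap y) at h1
    rw [hy x hx] at h1
    exact h1.symm
  · have e := congrArg (fun φ => SemiGraph.Hom.vertexMap φ y) (Dg.treeTrans_over h)
    simpa only [SemiGraph.comp_vertexMap, Function.comp_apply] using e

end Tower

variable (p : ℕ) [hp : Fact p.Prime] (n : ℕ → ℕ)

/-! ### The far branch orders at `𝒢_θ(p,n)` -/

/-- **The far branch generators of each level have one common order `p^{e₀}`** (the yardstick is the escaping
element `c` of the standard apartment: abc-iut-L3-d4's `thetaRay_orderOf_gal_brHom_eq_of_far`, p477446):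
for every schedule `n_k → ∞` there are thresholds `N_c(n₀)` such that at every level `n₀`, for some `e₀`,
every branch generator `σ_{n₀}^{b_*(1)}` at a vertex `w ≥ N_c(n₀) + 1` has order `p^{e₀}`.
[cite: MochizukiSemiAnbd2006, Thm 3.7(iv) p.41] -/
theorem thetaRayFreeProP_exists_far_orderOf_eq (hn : Tendsto n atTop atTop)
    (h36 : (thetaRayFreeProP p n).Prop36Hypotheses) :
    ∃ Nc : ℕ → ℕ, ∀ n₀ : ℕ, ∃ e₀ : ℕ, ∀ w, Nc n₀ + 1 ≤ w →
      ∀ (b : ℕ × Bool) (hb : SemiGraph.ray.abuts b = some w)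
        (P : ((thetaRayFreeProP p n).galoisLevelData h36).PointSeq h36.isCountable w),
        orderOf (P.gal n₀ ((thetaRayFreeProP p n).brHom b w hb (ofAdd (1 : ℤ_[p])))) = p ^ e₀ := by
  classical
  let Dg : GaloisLevelData (thetaRayFreeProP p n) := (thetaRayFreeProP p n).galoisLevelData h36
  have hc := h36.isCountable
  obtain ⟨Pa⟩ := thetaRay_nonempty_pointSeq_zero (G := Grp p) (E := Multiplicative ℤ_[p]) (up := α p)
    (low := fun k => θα p (n k)) h36
  have hcoin : ∀ d : ℕ, ∃ N : ℕ, ∀ k, N ≤ k →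
      ((fun k => θα p (n k)) (k + 1) (ofAdd (1 : ℤ_[p])))⁻¹ * α p (ofAdd 1) ∈ charOpenCore (Grp p) d :=
    FreeProPRankTwo.hcoin_concrete p n hn
  obtain ⟨hz, -, -⟩ := thetaRay_levelEscape_data (G := Grp p) (E := Multiplicative ℤ_[p]) (up := α p)
    (low := fun k => θα p (n k)) h36 Pa (ofAdd (1 : ℤ_[p])) hcoin
  set z : ℕ → Dg.temperedPi hc := fun k =>
    (rayPointSeq (D := Dg) thetaRay_ham thetaRay_hap thetaRay_hmp Pa (k + 1)).decompHom
      ((thetaRayFreeProP p n).brHom (k, true) (k + 1) (thetaRay_hap k) (ofAdd (1 : ℤ_[p]))) with hzdef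
  obtain ⟨c, hcN⟩ := Dg.exists_forall_eventually_projAut_eq hc z hz
  choose Nc hN using hcN
  have hN' : ∀ j k, Nc j ≤ k → Dg.proj hc j c = Dg.proj hc j (z k) := hN
  refine ⟨Nc, fun n₀ => ?_⟩
  obtain ⟨e₀, he₀⟩ : ∃ e₀ : ℕ, orderOf (Dg.proj hc n₀ c) = p ^ e₀ := by
    obtain ⟨e, he⟩ := thetaRayFreeProP_exists_orderOf_gal_eq_pow p n h36
      (rayPointSeq (D := Dg) thetaRay_ham thetaRay_hap thetaRay_hmp Pa (Nc n₀ + 1)) n₀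
      ((thetaRayFreeProP p n).brHom (Nc n₀, true) (Nc n₀ + 1) (thetaRay_hap (Nc n₀)) (ofAdd (1 : ℤ_[p])))
    refine ⟨e, ?_⟩
    rw [hN' n₀ (Nc n₀) le_rfl]
    exact he
  refine ⟨e₀, fun w hw b hb P => ?_⟩
  rw [← he₀]
  exact thetaRay_orderOf_gal_brHom_eq_of_far (G := Grp p) (E := Multiplicative ℤ_[p]) (up := α p)
    (low := fun k => θα p (n k)) h36 Pa (ofAdd (1 : ℤ_[p])) c Nc hN' n₀ b w hb hw P

/-! ### The general (♦) -/

/-- **(♦) IN GENERAL: DEEP `g`-FIXED VERTICES PROJECT ONTO `K`-FIXED VERTICES.**  At `𝒢_θ(p,n)`, with the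
shallow level `n₀` and its thresholds fixed as in `thetaRayFreeProP_frame_induction_gen` and an INITIAL FRAME of
`(g, K)` at the deep level `N'` — a point sequence `P₀` over a vertex `w₀`, a branch `b₀` at `w₀`, with
`ρ_{N'}(g) = σ_{N'}^{b₀*(λ₀)}`, `‖p^m‖ ≤ ‖λ₀‖`, and `ρ_{n₀}(k) ∈ σ_{n₀}^{b₀*(ℤ_p)}` for every `k ∈ K` — every
vertex of `𝔾̃_{N'}` fixed by `g` maps to a vertex of `𝔾̃_{n₀}` fixed by every element of `K`.
[cite: MochizukiSemiAnbd2006, Thm 3.7(iv) p.41] -/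
theorem thetaRayFreeProP_deepFixed_proj_fixed_gen (h36 : (thetaRayFreeProP p n).Prop36Hypotheses)
    (g : ((thetaRayFreeProP p n).galoisLevelData h36).temperedPi h36.isCountable)
    (K : Set (((thetaRayFreeProP p n).galoisLevelData h36).temperedPi h36.isCountable))
    (m N' : ℕ) {n₀ : ℕ} (hnN : n₀ ≤ N') (e₀ : ℕ) (hm : m < e₀)
    (horder : orderOf (((thetaRayFreeProP p n).galoisLevelData h36).proj h36.isCountable n₀ g) = p ^ (e₀ - m))
    (d : ℕ)
    (hV : ∀ (w : ℕ) (P : ((thetaRayFreeProP p n).galoisLevelData h36).PointSeq h36.isCountable w) (v : Grp p),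
      v ∈ charOpenCore (Grp p) d → P.gal n₀ v = 1)
    (k₁ : ℕ) (htwist : ∀ k, k₁ ≤ k → ∀ x : Grp p, θ p (n k) x * x⁻¹ ∈ charOpenCore (Grp p) d)
    (F₀ : ℕ) (hfarord : ∀ w, F₀ ≤ w → ∀ (b : ℕ × Bool) (hb : SemiGraph.ray.abuts b = some w)
      (P : ((thetaRayFreeProP p n).galoisLevelData h36).PointSeq h36.isCountable w),
      orderOf (P.gal n₀ ((thetaRayFreeProP p n).brHom b w hb (ofAdd (1 : ℤ_[p])))) = p ^ e₀)
    (hshift : ∀ (w : ℕ) (P : ((thetaRayFreeProP p n).galoisLevelData h36).PointSeq h36.isCountable w)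
      (b₁ b₂ : ℕ × Bool) (hb₁ : SemiGraph.ray.abuts b₁ = some w) (hb₂ : SemiGraph.ray.abuts b₂ = some w)
      (f₁ f₂ y₁ y₂ : Grp p) (k k₂ : Multiplicative ℤ_[p]), ‖(p : ℤ_[p]) ^ m‖ ≤ ‖k₂.toAdd‖ →
      y₁ = (thetaRayFreeProP p n).brHom b₁ w hb₁ k → y₂ = (thetaRayFreeProP p n).brHom b₂ w hb₂ k₂ →
      P.gal N' (f₁ * y₁ * f₁⁻¹) = P.gal N' (f₂ * y₂ * f₂⁻¹) →
      ∃ (π : Multiplicative ℤ_[p]) (y v : Grp p), y = (thetaRayFreeProP p n).brHom b₂ w hb₂ π ∧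
        v ∈ charOpenCore (Grp p) d ∧ f₂⁻¹ * f₁ = y * v)
    (hfarx : ∀ y : (((thetaRayFreeProP p n).galoisLevelData h36).tree N').Vertex,
      (((thetaRayFreeProP p n).galoisLevelData h36).treeAct h36.isCountable N' g).hom.vertexMap y = y →
        k₁ ≤ (((thetaRayFreeProP p n).galoisLevelData h36).treeProj N').vertexMap y ∧
        F₀ ≤ (((thetaRayFreeProP p n).galoisLevelData h36).treeProj N').vertexMap y)
    {w₀ : ℕ} (P₀ : ((thetaRayFreeProP p n).galoisLevelData h36).PointSeq h36.isCountable w₀)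
    (b₀ : ℕ × Bool) (hb₀ : SemiGraph.ray.abuts b₀ = some w₀) (l₀ : Multiplicative ℤ_[p])
    (hl₀ : ‖(p : ℤ_[p]) ^ m‖ ≤ ‖l₀.toAdd‖)
    (hI1₀ : ((thetaRayFreeProP p n).galoisLevelData h36).proj h36.isCountable N' g =
      P₀.gal N' ((thetaRayFreeProP p n).brHom b₀ w₀ hb₀ l₀))
    (hI2₀ : ∀ k ∈ K, ∃ u : Multiplicative ℤ_[p],
      ((thetaRayFreeProP p n).galoisLevelData h36).proj h36.isCountable n₀ k =
        P₀.gal n₀ ((thetaRayFreeProP p n).brHom b₀ w₀ hb₀ u))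
    (yy : (((thetaRayFreeProP p n).galoisLevelData h36).tree N').Vertex)
    (hyy : (((thetaRayFreeProP p n).galoisLevelData h36).treeAct h36.isCountable N' g).hom.vertexMap yy = yy) :
    ∀ k ∈ K, (((thetaRayFreeProP p n).galoisLevelData h36).treeAct h36.isCountable n₀ k).hom.vertexMap
        ((((thetaRayFreeProP p n).galoisLevelData h36).treeTrans hnN).vertexMap yy) =
      (((thetaRayFreeProP p n).galoisLevelData h36).treeTrans hnN).vertexMap yy := by
  classical
  let Dg := (thetaRayFreeProP p n).galoisLevelData h36
  have hc36 := h36.isCountable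
  have hT := (Dg.isTree_tree N').isTree
  -- the geodesic from `P₀.vertex N'` to `yy`
  let q : (Dg.tree N').subdivision.Path (Sum.inl (P₀.vertex N')) (Sum.inl yy) :=
    (hT.connected (Sum.inl (P₀.vertex N')) (Sum.inl yy)).some.toPath
  obtain ⟨w', P', b', hb', l', y', -, -, -, hI2', hv⟩ :=
    thetaRayFreeProP_frame_induction_gen p n h36 g K m N' hnN e₀ hm horder d hV k₁ htwist F₀ hfarord hshift hfarx
      q.1.length P₀ b₀ hb₀ l₀ ((thetaRayFreeProP p n).brHom b₀ w₀ hb₀ l₀) rfl hl₀ hI1₀ hI2₀ yy q.1 q.2 le_rfl hyy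
  intro k hk
  obtain ⟨u, hu⟩ := hI2' k hk
  have hfix := treeAct_vertexMap_vertex_of_proj_eq p n h36 P' n₀ k _ hu
  rw [← P'.treeTrans_vertex hnN, hv] at hfix
  exact hfix

end ProfiniteSemiGraph

end Literature.AnabelianGeometry.SemiGraphs

end
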